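import Summits.BirchSwinnertonDyer.BirchSwinnertonDyer.Theorems.KimAtThreeDeepUpperOfPortsClasswide
import Literature.NumberTheory.EllipticCurves.IsogenyIdProofs
import Summits.BirchSwinnertonDyer.BirchSwinnertonDyer.Theorems.KimAtThreeKolyvaginIsogenyCruxes
import Literature.NumberTheory.EllipticCurves.SelmerCorankControlRatProofs
import HarnessLib

/-!
# Route `KimAtThreeKolyvagin` (rung W2): the GLUE item `ShallowEqDeepOfParts` (stmt-BirchSwinnertonDyer-19600)
# of the §S tenure split (v2, k = 2) of crux `ShallowEqDeepAtTorsionFree` (item 19077) — PROVED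

Cell `bsd-addord`, seat `bsd-addord-w2-c2` (gen 3), landing the planner's kernel-checked glue (planner
bsd-addord-plan g15, `HOME/planner/splitW2/EnvW2S2.lean`, theorem `shallowEqDeepOfParts2_proof`, rc 0;
director-bsd GO 2026-08-26T10:01:17Z; route rev 6). ONE theorem, no definition, no named fact, no `sorry`;
it closes the GLUE item 19600 by type-match (`… : …Theses.KimAtThreeKolyvagin.ShallowEqDeepOfParts`) and
nothing else: the alias conjunction 19598 `DeepUpperSplitSharedParts` is the six §U parts by name (Sakamoto
2024 Thm 4.4 ×2, Gross–Zagier–Kolyvagin, Poitou–Tate, Carayol — PUBLISHED inputs; the shared-generator PORT″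
19560, FLAG K22-Thm3.13-PORT@3; the stub 19561), and the complement crux 19599 `ShallowEqDeepOffKatoStratum`
stays OPEN. HONEST FRAMING: BSD is not proved by any of this; a closed glue is bookkeeping of rung W2, never
summit credit.

## Proof (verbatim the planner's EnvW2S2 proof)

Destructure the alias conjunction; reduce `ShallowEqDeepAtTorsionFree` to lattice-optimal, degree-minimal data
at the conductor (kim3 g9, `KimAtThreeKolyvaginIsogenyCruxes.shallowEqDeepAtTorsionFree_of_forall_optimalDatum_atConductor`,
Carayol); `by_cases` on the Kato stratum `Addv W₀ 3 ∧ 3 ∤ c₃ ∧ 3 ∤ c_{D₀}` (`t = 0` is the parent's own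
binder): ON it, w2-c3's `KimAtThreeDeepUpperOfPortsClasswide.shallowEqDeep_conclusion_classwide_of_ports_of_stub`
(p435413) with `W = W₀` (`IsIsogenous.refl_holds`), the place `v₃ ∣ 3` and one generator family `η` constructed
here, the port and the stub instantiated at them; OFF it, the complement child verbatim.

References: [Sakamoto2024] Thm. 4.4; [MazurRubin2004] Thm. 4.4.1, 5.2.12; [Kim2022StructureSelmer] Thm. 3.13,
Thm. 1.9 (6); [Kim2025RefinedTNC] Thm. 1.1/1.2; [Carayol1986]; [MilneADT2006] I Thm. 4.10; planner memo
`HOME/planner/SPLIT-DRAFTS-W2-g15.md` §S.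
-/

-- the Theorems namespace of a single-conjunct summit repeats the summit name by design (D-0017)
set_option linter.dupNamespace false

noncomputable section

namespace Summit.BirchSwinnertonDyer.BirchSwinnertonDyer.Theorems.KimAtThreeShallowEqDeepSplitGlue

open scoped Classical NumberField
open Function IsDedekindDomain NumberField WeierstrassCurve
  Literature.NumberTheory.EllipticCurves Literature.NumberTheory.EllipticCurves.ModularForms
  Literature.NumberTheory.EllipticCurves.Rank1Residual
  Literature.NumberTheory.GaloisCohomology
  Summit.BirchSwinnertonDyer.Rank1Residual.GaloisImage
  Summit.BirchSwinnertonDyer.BirchSwinnertonDyer.Theorems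
  Summit.BirchSwinnertonDyer.BirchSwinnertonDyer.Theorems.KimAtThreeDeepUpperOfPortsClasswide
  Summit.BirchSwinnertonDyer.BirchSwinnertonDyer.Theorems.KimAtThreeKolyvaginIsogenyCruxes

/-- **Glue item 19600 `ShallowEqDeepOfParts`, PROVED**: `DeepUpperSplitSharedParts → ShallowEqDeepOffKatoStratum
→ ShallowEqDeepAtTorsionFree` (planner EnvW2S2 proof: destructure the six shared §U parts, optimal-datum-at-
conductor reduction, then w2-c3's class-wide Kato-stratum corollary ON the stratum / the complement child OFF
it). [cite: Kim2025RefinedTNC, Thm. 1.1 and Thm. 1.2] [cite: Sakamoto2024, Thm. 4.4 (p. 926)]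
[cite: MazurRubin2004, Thm. 4.4.1 and Thm. 5.2.12] [cite: Carayol1986] -/
theorem shallowEqDeepOfParts_proof :
    Summit.BirchSwinnertonDyer.BirchSwinnertonDyer.Theses.KimAtThreeKolyvagin.ShallowEqDeepOfParts := by
  rintro ⟨hSak, hGZK, hPT, hlev, hPort, hStub⟩ hOff
  refine shallowEqDeepAtTorsionFree_of_forall_optimalDatum_atConductor hlev ?_
  intro W₀ _ _ htow ht0 hfin N _ hN D₀ hopt hdeg hint hord
  by_cases hroad :
      ((haveI : Fact (Nat.Prime 3) := ⟨Nat.prime_three⟩; Addv W₀ 3) ∧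
        ¬ 3 ∣ (W₀.baseChange ℚ_[3]).localTamagawaNumber ℤ_[3] ∧
        ¬ (3 : ℤ) ∣ D₀.maninConstant)
  · obtain ⟨hadd, hc3, hcD⟩ := hroad
    -- the place above 3
    let v₃ : HeightOneSpectrum (𝓞 ℚ) := (Rat.HeightOneSpectrum.primesEquiv (R := 𝓞 ℚ)).symm ⟨3, Nat.prime_three⟩
    have hgen3 : Rat.HeightOneSpectrum.natGenerator v₃ = 3 :=
      congrArg Subtype.val ((Rat.HeightOneSpectrum.primesEquiv (R := 𝓞 ℚ)).apply_symm_apply ⟨3, Nat.prime_three⟩)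
    have hv₃ : ((3 : ℕ) : 𝓞 ℚ) ∈ v₃.asIdeal := by
      have h := Rat.HeightOneSpectrum.natCast_natGenerator_mem v₃
      rwa [hgen3] at h
    -- one generator family η
    have hgen : ∀ q : HeightOneSpectrum (𝓞 ℚ), ∃ η : (ZMod (Ideal.absNorm q.asIdeal))ˣ,
        Subgroup.zpowers η = ⊤ := fun q => by
      haveI : Fact (Ideal.absNorm q.asIdeal).Prime := ⟨FSComp.prime_absNorm_rat q⟩
      obtain ⟨g, hg⟩ := IsCyclic.exists_generator (α := (ZMod (Ideal.absNorm q.asIdeal))ˣ)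
      exact ⟨g, (Subgroup.eq_top_iff' _).mpr hg⟩
    choose η hη using hgen
    exact shallowEqDeep_conclusion_classwide_of_ports_of_stub hSak.1 hSak.2 hGZK hPT W₀ W₀
      (IsIsogenous.refl_holds W₀) hadd htow ht0 hc3 hN D₀ hopt hcD hint v₃ hv₃ η hη
      (hPort W₀ htow hadd hc3 ht0 v₃ hv₃ η hη D₀ hN hopt hcD) (hStub W₀ htow η hη) hord
  · exact hOff W₀ htow ht0 hfin hN D₀ hopt hdeg hint hord hroad


end Summit.BirchSwinnertonDyer.BirchSwinnertonDyer.Theorems.KimAtThreeShallowEqDeepSplitGlue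

end
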